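import Summits.QuantumFields.BalabanUV.Beta.FP.NestedStepLawJets
import Summits.QuantumFields.BalabanUV.Beta.FP.KKTCornerReduction

/-!
# The nested step law at jet level with the `ρ₁`-corner killed: the block system IS the coarse sliced system (road «FP», route T row (T-INST-j))

Owner file of road «FP» (unit `b2b-balaban-beta-d1-p3`, gen 16), ruling R-FP-51 («ROUTE T»).  `NestedStepLawJets.secondVar_nestedStepLaw_polynomial` states the
nested step law among twelve matrices with the block system bordered by `P̃ = [[Q₂,0],[τ₂,0],[0,1]]` on `μ ⊕ ρ₁` (the fine slice multipliers `ρ₁` ride along as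
a unit corner).  `KKTCornerReduction.secondVar_kkt_killRows` removes that corner along curves.  Here the two are COMPOSED, jet level throughout:
* §1 `toBlocks₁₁` bookkeeping and the jet form of the corner reduction (`secondVar_kkt_killRows_jets`: three matrices a side, one invertibility);
* §2 **`secondVar_nestedStepLaw_corner`**: composite = fine one-step + COARSE SLICED system `kkt (𝔊₁₁ + G) [Q₂;τ₂]` on `μ`, every jet displayed, the block
  system's non-degeneracy hypothesis stated for the coarse sliced system itself.
On the torus (rows (T-INST-j)/(T-ID)) the coarse sliced system is the level-`(j+1, m)` system: this is the finite-`j` semigroup law's exact shape.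

HONEST: finite-dimensional algebra at model level; nothing here is the road's (SDF), (D1), BetaPertH, a continuum statement or Clay.
-/

noncomputable section

namespace Summit.QuantumFields.BalabanUV.Beta.FP.NestedStepLawJetsCorner

open Matrix Filter Finset
open scoped Topology
open Literature.MathematicalPhysics.QuantumFieldTheory.Balaban1983to89.Beta.Composition (kkt)
open Literature.MathematicalPhysics.QuantumFieldTheory.Balaban1983to89.Beta.CompositionSingular (effForm flucCov minOp minOpL)
open Summit.QuantumFields.BalabanUV.Beta.D1BFx.LogDetSecondVariation (secondVar)
open Summit.QuantumFields.BalabanUV.Beta.FP.NestedStepLawJets (hasDerivAt_quadCurve hasDerivAt_linCurve secondVar_nestedStepLaw_polynomial)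
open Summit.QuantumFields.BalabanUV.Beta.FP.KKTCornerReduction (det_kkt_killRows secondVar_kkt_killRows)

/-! ## §1 Corner bookkeeping and the jet form of the corner reduction -/

section Corner

variable {μ κ ρ : Type*} [Fintype μ] [Fintype κ] [Fintype ρ] [DecidableEq μ] [DecidableEq κ] [DecidableEq ρ]

omit [Fintype μ] [Fintype κ] [Fintype ρ] [DecidableEq μ] [DecidableEq κ] [DecidableEq ρ] in
/-- [folklore] the live corner of `X + (G ⊕ 0)` is `X₁₁ + G`. -/
theorem toBlocks₁₁_add_blockDiag (X : Matrix (μ ⊕ ρ) (μ ⊕ ρ) ℝ) (G : Matrix μ μ ℝ) :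
    (X + fromBlocks G (0 : Matrix μ ρ ℝ) (0 : Matrix ρ μ ℝ) (0 : Matrix ρ ρ ℝ)).toBlocks₁₁ = X.toBlocks₁₁ + G := by
  ext i j
  simp only [Matrix.toBlocks₁₁, Matrix.of_apply, Matrix.add_apply, Matrix.fromBlocks_apply₁₁]

/-- [folklore] **THE CORNER REDUCTION AT JET LEVEL**: for ANY three form matrices `E₀, E₁, E₂` on `μ ⊕ ρ` and border matrices `P₀, P₁, P₂`, with the live corner
system `kkt (E₀)₁₁ P₀` non-degenerate, `secondVar (kkt E₀ [[P₀,0],[0,1]]) (kkt E₁ [[P₁,0],[0,0]]) (kkt E₂ [[P₂,0],[0,0]]) = secondVar (kkt (E₀)₁₁ P₀) (kkt (E₁)₁₁ P₁) (kkt (E₂)₁₁ P₂)`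
(`KKTCornerReduction.secondVar_kkt_killRows` along the quadratic curves `X₀ + uX₁ + ½u²X₂`). -/
theorem secondVar_kkt_killRows_jets (E₀ E₁ E₂ : Matrix (μ ⊕ ρ) (μ ⊕ ρ) ℝ) (P₀ P₁ P₂ : Matrix κ μ ℝ) (h0 : (kkt E₀.toBlocks₁₁ P₀).det ≠ 0) :
    secondVar (kkt E₀ (fromBlocks P₀ (0 : Matrix κ ρ ℝ) (0 : Matrix ρ μ ℝ) (1 : Matrix ρ ρ ℝ)))
        (kkt E₁ (fromBlocks P₁ (0 : Matrix κ ρ ℝ) (0 : Matrix ρ μ ℝ) (0 : Matrix ρ ρ ℝ)))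
        (kkt E₂ (fromBlocks P₂ (0 : Matrix κ ρ ℝ) (0 : Matrix ρ μ ℝ) (0 : Matrix ρ ρ ℝ)))
      = secondVar (kkt E₀.toBlocks₁₁ P₀) (kkt E₁.toBlocks₁₁ P₁) (kkt E₂.toBlocks₁₁ P₂) := by
  have h0' : (kkt (Matrix.of ((fun v : ℝ => Matrix.of.symm (E₀ + v • E₁ + (v ^ 2 / 2) • E₂)) 0)).toBlocks₁₁
      (Matrix.of ((fun v : ℝ => Matrix.of.symm (P₀ + v • P₁ + (v ^ 2 / 2) • P₂)) 0))).det ≠ 0 := by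
    simpa using h0
  have h := secondVar_kkt_killRows
    (Eventually.of_forall (hasDerivAt_quadCurve E₀ E₁ E₂)) (hasDerivAt_linCurve E₁ E₂ 0)
    (Eventually.of_forall (hasDerivAt_quadCurve P₀ P₁ P₂)) (hasDerivAt_linCurve P₁ P₂ 0) h0'
  simpa using h

end Corner

/-! ## §2 The nested step law with the corner killed -/

section Law

variable {ν μ κ ρ₁ ρ₂ : Type*} [Fintype ν] [Fintype μ] [Fintype κ] [Fintype ρ₁] [Fintype ρ₂]
  [DecidableEq ν] [DecidableEq μ] [DecidableEq κ] [DecidableEq ρ₁] [DecidableEq ρ₂]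

/-- [folklore] **THE NESTED STEP LAW, ANALYSIS-FREE, CORNER KILLED (route T's (T-INST-j) target shape).**  DATA as in
`NestedStepLawJets.secondVar_nestedStepLaw_polynomial` (twelve matrices, two static slices, the blocks `Γ, 𝓘, 𝓘ᴸ, 𝔊` of the inverse of the fine sliced system and
`B = [Q₁₁;0]` NAMED), with the block system's non-degeneracy stated for the COARSE SLICED SYSTEM `kkt (𝔊₁₁ + G₀) [Q₂₀;τ₂]` on `μ`.  CONCLUSION:
second variation of the composite sliced system = that of the fine one-step sliced system + that of the COARSE SLICED SYSTEM, whose form jets are the live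
corners `(E₁)₁₁ + G₁`, `(E₂)₁₁ + G₂` of the displayed block words and whose border jets are `[Q₂₁;0]`, `[Q₂₂;0]`.  ZERO STEP DEFECT, no `ρ₁`-corner left. -/
theorem secondVar_nestedStepLaw_corner
    (H₀ H₁ H₂ : Matrix ν ν ℝ) (Q₁₀ Q₁₁ Q₁₂ : Matrix μ ν ℝ) (Q₂₀ Q₂₁ Q₂₂ : Matrix κ μ ℝ) (G₀ G₁ G₂ : Matrix μ μ ℝ)
    (τ₁ : Matrix ρ₁ ν ℝ) (τ₂ : Matrix ρ₂ μ ℝ)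
    {Γ : Matrix ν ν ℝ} {I : Matrix ν (μ ⊕ ρ₁) ℝ} {L : Matrix (μ ⊕ ρ₁) ν ℝ} {S : Matrix (μ ⊕ ρ₁) (μ ⊕ ρ₁) ℝ} {B : Matrix (μ ⊕ ρ₁) ν ℝ}
    (hΓ : flucCov H₀ (fromRows Q₁₀ τ₁) = Γ) (hI : minOp H₀ (fromRows Q₁₀ τ₁) = I) (hL : minOpL H₀ (fromRows Q₁₀ τ₁) = L) (hS : effForm H₀ (fromRows Q₁₀ τ₁) = S)
    (hB : fromRows Q₁₁ (0 : Matrix ρ₁ ν ℝ) = B)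
    (h1 : (kkt H₀ (fromRows Q₁₀ τ₁)).det ≠ 0)
    (h2 : (kkt (S.toBlocks₁₁ + G₀) (fromRows Q₂₀ τ₂)).det ≠ 0) :
    secondVar
        (kkt (H₀ + Q₁₀ᵀ * G₀ * Q₁₀) (fromRows (fromRows (Q₂₀ * Q₁₀) (τ₂ * Q₁₀)) τ₁))
        (kkt (H₁ + (Q₁₁ᵀ * G₀ * Q₁₀ + Q₁₀ᵀ * G₁ * Q₁₀ + Q₁₀ᵀ * G₀ * Q₁₁)) (fromRows (fromRows (Q₂₁ * Q₁₀ + Q₂₀ * Q₁₁) (τ₂ * Q₁₁)) (0 : Matrix ρ₁ ν ℝ)))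
        (kkt (H₂ + ((Q₁₂ᵀ * G₀ * Q₁₀ + Q₁₁ᵀ * G₁ * Q₁₀ + Q₁₁ᵀ * G₀ * Q₁₁) + (Q₁₁ᵀ * G₁ * Q₁₀ + Q₁₀ᵀ * G₂ * Q₁₀ + Q₁₀ᵀ * G₁ * Q₁₁)
            + (Q₁₁ᵀ * G₀ * Q₁₁ + Q₁₀ᵀ * G₁ * Q₁₁ + Q₁₀ᵀ * G₀ * Q₁₂)))
          (fromRows (fromRows (Q₂₂ * Q₁₀ + Q₂₁ * Q₁₁ + (Q₂₁ * Q₁₁ + Q₂₀ * Q₁₂)) (τ₂ * Q₁₂)) (0 : Matrix ρ₁ ν ℝ)))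
      = secondVar (kkt H₀ (fromRows Q₁₀ τ₁)) (kkt H₁ B) (kkt H₂ (fromRows Q₁₂ (0 : Matrix ρ₁ ν ℝ)))
        + secondVar
            (kkt (S.toBlocks₁₁ + G₀) (fromRows Q₂₀ τ₂))
            (kkt (((L * H₁ - S * B) * I - L * Bᵀ * S).toBlocks₁₁ + G₁) (fromRows Q₂₁ (0 : Matrix ρ₂ μ ℝ)))
            (kkt ((((-((L * H₁ - S * B) * Γ + L * Bᵀ * L) * H₁ + L * H₂
                      - (((L * H₁ - S * B) * I - L * Bᵀ * S) * B + S * fromRows Q₁₂ (0 : Matrix ρ₁ ν ℝ))) * I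
                    + (L * H₁ - S * B) * (-((Γ * H₁ + I * B) * I - Γ * Bᵀ * S)))
                  - ((-((L * H₁ - S * B) * Γ + L * Bᵀ * L) * Bᵀ + L * (fromRows Q₁₂ (0 : Matrix ρ₁ ν ℝ))ᵀ) * S
                      + L * Bᵀ * ((L * H₁ - S * B) * I - L * Bᵀ * S))).toBlocks₁₁ + G₂)
              (fromRows Q₂₂ (0 : Matrix ρ₂ μ ℝ))) := by
  -- the block system on `μ ⊕ ρ₁` is non-degenerate iff its live corner is (`det_kkt_killRows`)
  have h2' : (kkt (S + fromBlocks G₀ (0 : Matrix μ ρ₁ ℝ) (0 : Matrix ρ₁ μ ℝ) (0 : Matrix ρ₁ ρ₁ ℝ))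
      (fromBlocks (fromRows Q₂₀ τ₂) (0 : Matrix (κ ⊕ ρ₂) ρ₁ ℝ) (0 : Matrix ρ₁ μ ℝ) (1 : Matrix ρ₁ ρ₁ ℝ))).det ≠ 0 := by
    rw [det_kkt_killRows, toBlocks₁₁_add_blockDiag]
    exact mul_ne_zero (pow_ne_zero _ (by norm_num)) h2
  have h := secondVar_nestedStepLaw_polynomial H₀ H₁ H₂ Q₁₀ Q₁₁ Q₁₂ Q₂₀ Q₂₁ Q₂₂ G₀ G₁ G₂ τ₁ τ₂ hΓ hI hL hS hB h1 h2'
  have h2c : (kkt (S + fromBlocks G₀ (0 : Matrix μ ρ₁ ℝ) (0 : Matrix ρ₁ μ ℝ) (0 : Matrix ρ₁ ρ₁ ℝ)).toBlocks₁₁ (fromRows Q₂₀ τ₂)).det ≠ 0 := by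
    rw [toBlocks₁₁_add_blockDiag]; exact h2
  rw [secondVar_kkt_killRows_jets _ _ _ _ _ _ h2c, toBlocks₁₁_add_blockDiag, toBlocks₁₁_add_blockDiag, toBlocks₁₁_add_blockDiag] at h
  exact h

end Law

end Summit.QuantumFields.BalabanUV.Beta.FP.NestedStepLawJetsCorner

end
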